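import Mathlib.Data.Sym.Card
import Mathlib.Data.Fintype.Vector
import Summits.ValiantsHypothesis.ValiantsHypothesis.Theorems.KPlusLogSqLawTropicalBToeplitzAdditive
import Summits.ValiantsHypothesis.ValiantsHypothesis.Theorems.KPlusLogSqLawTropicalBSmallFormats

/-!
# `TropicalB` / Toeplitz sector — `K`-valued slope functions («Conjecture T_K»), part A: the slope-class count and its thin closure

HONEST FRAMING.  Object-search cell `pub-symmetroid` (Valiant); helper typing for the OPEN crux `TropicalB`
(stmt-ValiantsHypothesis-19771, route `KPlusLogSqLaw`, registered stub `stub_tropFat` NOT touched).  Typed from the ideation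
seat's farm-checked sketch `HOME/pub-symmetroid-conjb-1/g5/lean/ToeplitzSlopeClass.lean` (conjb-1 g5, 2026-08-26; proofs
verbatim, namespace suffix `.ConjB1G5` dropped, the two primed sanity theorems omitted, file split in two at the 400-line
rule).  Nothing here proves `stub_tropFat`, `TropicalB`, `KPlusLogSqLaw`, `MatrixDescartes` (stmt-ValiantsHypothesis-18050) or
anything about `VP ≠ VNP`; every statement is a definition (`Prop`, nothing asserted), a trivial implication between such
`Prop`s, a counting lemma, or a CONDITIONAL reduction.


OBSERVATION (read off the tree proof `toeplitz_chain_le_of_linearBound`, p429098): the reduction applies its hypothesis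
`Φ_Toep(m) ≤ Φ` only at the slope function `ψ := d ∘ c` (`c : ℤ → Fin K` the arg-max class selection of a level,
`d : Fin K → ℕ` the design's slopes) — a slope function with AT MOST `K` VALUES — and at `ψ = 0` (for `1 ≤ Φ`).  Hence the
Toeplitz-sector payoff `toeplitz_sector_kPlusLogSq_of_polyBound` / `toeplitzSector_of_conjectureTPoly` needs, instead of
polynomial Conjecture T (a bound uniform over ALL slope functions), only the LAW-SHAPED and formally weaker

  «Conjecture T_K»:  `∃ C, ∀ m K, Φ_Toep(m, K) ≤ 2 ^ (C (K + ⌊log₂ m⌋²))`,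

where `Φ_Toep(m, K)` counts, for slope functions `ψ = w ∘ c` with `c : ℤ → Fin K`, `w : Fin K → ℤ` (intercepts and admissible
set free), the pairwise distinct admissible permutations that are unique optima at strictly increasing integer slopes.
`ConjectureTPoly → ConjectureTK` is one line (`(m+1)^c ≤ 2^{c(K + log² m)}` for `K ≥ 1`; `K = 0` is vacuous), and
`toeplitzSector_of_conjectureTK` has LITERALLY the conclusion of `toeplitzSector_of_conjectureTPoly` (constant `C + 7`).
Paper closures (memo `ROUND5-MEMO.md` §1): `Φ_Toep(m, K) ≤ C(m+K-1, K-1)` (class histograms strictly increase in `⟨w, ·⟩`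
along a chain) settles T_K for `K ≤ c·log m`; `Φ_Toep(m, K) ≤ Φ_Toep(m) ≤ #profiles < 6.75^m` settles it for `K ≥ c'·m`;
the OPEN WINDOW is `c log m < K < c' m` («O(1) bits per slope class»).

Contents: `SlopeClassInstanceBound` (+ `_of_linear`, `.mono`, `.anti`, `_zero`, `.one_le`), `ConjectureTK`, `ConjectureTKLinear`,
`slopeClassInstanceBound_multichoose` (histogram counting: `Φ_Toep(m,K) ≤ multichoose K m`; rows `K = 1, 2`; `_thin`),

Contents of part A: `SlopeClassInstanceBound` (+ `_of_linear`, `.mono`, `.anti`, `_zero`, `.one_le`), `ConjectureTK`,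
`ConjectureTKLinear`, `conjectureTK_of_conjectureTPoly`, `conjectureTKLinear_of_conjectureTLinear`,
`conjectureTK_of_conjectureTKLinear`, and the thin regime by histogram counting: `slopeClassInstanceBound_multichoose`
(`Φ_Toep(m,K) ≤ multichoose K m`), rows `K = 1, 2`, `_thin`.  Part B (`…TropicalBToeplitzSlopeClass.lean`): the refined
reduction `toeplitz_chain_le_of_slopeClassBound` and `toeplitzSector_of_conjectureTK`.

References: tree files `…TropicalBToeplitzReduction` (p429098), `…TropicalBToeplitzSectorLaw` (p447484),
`…TropicalBToeplitzConjectureT` (p453677); folklore (parametric linearisation).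
-/

set_option linter.dupNamespace false
set_option autoImplicit false

namespace Summit.ValiantsHypothesis.ValiantsHypothesis.Theorems.KPlusLogSqLaw.Toeplitz

open Summit.ValiantsHypothesis.ValiantsHypothesis.Theorems.KPlusLogSqLaw
open Summit.ValiantsHypothesis.ValiantsHypothesis.Theorems.KPlusLogSqLaw.Toeplitz
open Summit.ValiantsHypothesis.ValiantsHypothesis.Theorems.MatrixDescartes.Negative
open Summit.ValiantsHypothesis.ValiantsHypothesis.Theorems.LacunarySymmetroidMatrixDescartes
open Summit.ValiantsHypothesis.ValiantsHypothesis.Theorems.LacunarySymmetroidMatrixDescartes.TropicalCensus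
open scoped BigOperators
open Finset

/-! ## `K`-valued slope functions -/

section SlopeClass

/-- **«`Φ_Toep(m, K) ≤ Φ`»**: the count `FixedSlopeInstanceBound` for every slope function with AT MOST `K` VALUES,
presented as `ψ = w ∘ c` with a class selection `c : ℤ → Fin K` and class slopes `w : Fin K → ℤ` (intercepts `α` and the
admissible displacement set `P` stay free).  This — not `LinearInstanceBound` — is what the Toeplitz reduction consumes at
format `(m, K)`. -/
def SlopeClassInstanceBound (m K Φ : ℕ) : Prop :=
  ∀ (c : ℤ → Fin K) (w : Fin K → ℤ), FixedSlopeInstanceBound m (fun δ => w (c δ)) Φ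

/-- the full class bounds every `K`-valued class. -/
theorem slopeClassInstanceBound_of_linear {m Φ : ℕ} (K : ℕ) (h : LinearInstanceBound m Φ) :
    SlopeClassInstanceBound m K Φ :=
  fun c w => fixedSlope_of_linear h (fun δ => w (c δ))

/-- monotonicity in the bound. -/
theorem SlopeClassInstanceBound.mono {m K Φ Φ' : ℕ} (h : SlopeClassInstanceBound m K Φ) (hle : Φ ≤ Φ') :
    SlopeClassInstanceBound m K Φ' :=
  fun c w => (h c w).mono hle

/-- extensionality in the slope function. -/
theorem fixedSlopeInstanceBound_congr {m Φ : ℕ} {ψ ψ' : ℤ → ℤ} (h : FixedSlopeInstanceBound m ψ Φ)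
    (he : ∀ δ, ψ δ = ψ' δ) : FixedSlopeInstanceBound m ψ' Φ := by
  have hψ : ψ = ψ' := funext he
  subst hψ
  exact h

/-- antitonicity in the number of slope values: a `K`-valued slope function is `K'`-valued for `K ≤ K'`. -/
theorem SlopeClassInstanceBound.anti {m K K' Φ : ℕ} (h : SlopeClassInstanceBound m K' Φ) (hKK' : K ≤ K') :
    SlopeClassInstanceBound m K Φ := by
  intro c w
  refine fixedSlopeInstanceBound_congr
    (h (fun δ => Fin.castLE hKK' (c δ)) (fun j => if hj : (j : ℕ) < K then w ⟨j, hj⟩ else 0)) (fun δ => ?_)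
  have hlt : ((Fin.castLE hKK' (c δ) : Fin K') : ℕ) < K := by
    rw [Fin.val_castLE]; exact (c δ).isLt
  simp only [hlt, dif_pos]
  congr 1

/-- `K = 0`: no class selection exists (for any `m`, since `ℤ → Fin 0` is empty), the bound is vacuous. -/
theorem slopeClassInstanceBound_zero (m Φ : ℕ) : SlopeClassInstanceBound m 0 Φ :=
  fun c _ => Fin.elim0 (c 0)

/-- **Non-vacuity** for `K ≥ 1`: the one-member family `id` with only the displacement `0` admissible and `ψ = 0`
forces `1 ≤ Φ`. [folklore] -/
theorem SlopeClassInstanceBound.one_le {m K Φ : ℕ} (hK : 1 ≤ K) (h : SlopeClassInstanceBound m K Φ) : 1 ≤ Φ := by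
  refine h (fun _ => ⟨0, hK⟩) (fun _ => 0) (fun _ => 0) (fun δ => δ = 0) 0 (fun _ => 0) (fun _ => 1)
    (fun a b hab => ?_) (fun a b _ => Fin.ext (by have := a.isLt; have := b.isLt; omega)) (fun k b => by simp)
    (fun k σ' hσ' hP => ?_)
  · exfalso
    have h' := Fin.lt_def.mp hab
    have := a.isLt; have := b.isLt
    omega
  · exfalso
    apply hσ'
    ext b
    have hb := hP b
    simp only [Equiv.Perm.coe_one, id_eq]
    omega

/-- **CONJECTURE T_K** (law-shaped, the hypothesis the Toeplitz sector actually consumes): `Φ_Toep(m, K) ≤ 2^{C (K + log² m)}`.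
OPEN in the window `c·log m < K < c'·m` (cell pub-symmetroid, 2026-08-26); TRUE on paper for `K ≤ c log m` (histogram count
`C(m+K-1, K-1)`) and for `K ≥ c' m` (profile count); implied by `ConjectureTPoly`.  A `Prop`; nothing is asserted. -/
def ConjectureTK : Prop := ∃ C : ℕ, ∀ m K : ℕ, SlopeClassInstanceBound m K (2 ^ (C * (K + Nat.log 2 m ^ 2)))

/-- **CONJECTURE T_K, linear form**: `Φ_Toep(m, K) ≤ C·K·m + 1` (exact rows: `Φ_Toep(m, 1) = 1`, `Φ_Toep(m, 2) = m + 1`;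
located `Φ_Toep(m, 3) ≥ 16, 16, 17` at `m = 6, 7, 8`).  OPEN; implied by `ConjectureTLinear`; a `Prop`, nothing asserted. -/
def ConjectureTKLinear : Prop := ∃ C : ℕ, ∀ m K : ℕ, SlopeClassInstanceBound m K (C * K * m + 1)

/-- polynomial Conjecture T implies Conjecture T_K (with the same constant). [folklore] -/
theorem conjectureTK_of_conjectureTPoly (h : ConjectureTPoly) : ConjectureTK := by
  obtain ⟨c, hc⟩ := h
  refine ⟨c, fun m K => ?_⟩
  rcases Nat.eq_zero_or_pos K with hK | hK
  · subst hK; exact slopeClassInstanceBound_zero m _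
  · refine (slopeClassInstanceBound_of_linear K (hc m)).mono ?_
    set L := Nat.log 2 m with hL
    have hm : m + 1 ≤ 2 ^ (L + 1) := Nat.lt_pow_succ_log_self one_lt_two m
    have hLL : L ≤ L ^ 2 := by nlinarith
    have h1 : L * c ≤ L ^ 2 * c := Nat.mul_le_mul_right c hLL
    have h2 : c ≤ K * c := Nat.le_mul_of_pos_left c hK
    calc (m + 1) ^ c ≤ (2 ^ (L + 1)) ^ c := Nat.pow_le_pow_left hm c
      _ = 2 ^ ((L + 1) * c) := by rw [← pow_mul]
      _ ≤ 2 ^ (c * (K + L ^ 2)) := by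
          apply Nat.pow_le_pow_right (by norm_num)
          calc (L + 1) * c = L * c + c := by ring
            _ ≤ L ^ 2 * c + K * c := Nat.add_le_add h1 h2
            _ = c * (K + L ^ 2) := by ring

/-- linear Conjecture T implies linear Conjecture T_K. [folklore] -/
theorem conjectureTKLinear_of_conjectureTLinear (h : ConjectureTLinear) : ConjectureTKLinear := by
  obtain ⟨c, hc⟩ := h
  refine ⟨c, fun m K => ?_⟩
  rcases Nat.eq_zero_or_pos K with hK | hK
  · subst hK; exact slopeClassInstanceBound_zero m _
  · refine (slopeClassInstanceBound_of_linear K (hc m)).mono ?_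
    calc c * m ≤ c * K * m := by
          rw [mul_assoc]; exact Nat.mul_le_mul_left c (Nat.le_mul_of_pos_left m hK)
      _ ≤ c * K * m + 1 := Nat.le_succ _

/-- Conjecture T_K linear ⇒ Conjecture T_K (law-shaped). [folklore] -/
theorem conjectureTK_of_conjectureTKLinear (h : ConjectureTKLinear) : ConjectureTK := by
  obtain ⟨c, hc⟩ := h
  refine ⟨c + 2, fun m K => ?_⟩
  rcases Nat.eq_zero_or_pos K with hK | hK
  · subst hK; exact slopeClassInstanceBound_zero m _
  refine (hc m K).mono ?_
  set L := Nat.log 2 m with hL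
  have hm : m + 1 ≤ 2 ^ (L + 1) := Nat.lt_pow_succ_log_self one_lt_two m
  have hK2 : K ≤ 2 ^ K := Nat.lt_two_pow_self.le
  have hc2 : c ≤ 2 ^ c := Nat.lt_two_pow_self.le
  have hLL : L ≤ L ^ 2 := by nlinarith
  have hcK : c ≤ c * K := Nat.le_mul_of_pos_right c hK
  calc c * K * m + 1 ≤ 2 ^ c * 2 ^ K * 2 ^ (L + 1) := by
        have e1 : c * K * m ≤ 2 ^ c * 2 ^ K * m := Nat.mul_le_mul_right m (Nat.mul_le_mul hc2 hK2)
        have e0 : 1 ≤ 2 ^ c * 2 ^ K := Nat.one_le_iff_ne_zero.mpr (by positivity)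
        have e2 : 2 ^ c * 2 ^ K * m + 1 ≤ 2 ^ c * 2 ^ K * (m + 1) := by nlinarith
        exact (Nat.add_le_add_right e1 1).trans (e2.trans (Nat.mul_le_mul_left _ hm))
    _ = 2 ^ (c + K + (L + 1)) := by rw [← pow_add, ← pow_add]
    _ ≤ 2 ^ ((c + 2) * (K + L ^ 2)) := by
        apply Nat.pow_le_pow_right (by norm_num)
        nlinarith

end SlopeClass

/-! ## The thin regime closes by counting: `Φ_Toep(m, K) ≤ multichoose K m` -/

section Counting

variable {m K : ℕ}

/-- a `K`-valued slope sum is a function of the CLASS MULTISET of the permutation. [folklore] -/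
theorem sum_slopeClass_eq_multiset (c : ℤ → Fin K) (w : Fin K → ℤ) (σ : Equiv.Perm (Fin m)) :
    ∑ b, w (c ((σ b : ℤ) - b)) = ((univ.val.map fun b : Fin m => c ((σ b : ℤ) - b)).map w).sum := by
  rw [Multiset.map_map, Finset.sum_eq_multiset_sum]
  rfl

/-- **Histogram counting**: along a chain of a `K`-valued linear Toeplitz instance the class multisets
`{c (τ_k b − b) : b}` are pairwise distinct — their `w`-weighted sums are the slope sums, which strictly increase along the
chain (`chain_slopeSum_strictMono`, tree) — so `Φ_Toep(m, K) ≤ #Sym(Fin K, m) = multichoose K m = C(m+K−1, m)`.  Hence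
Conjecture T_K holds in the THIN regime `K ≤ c·log₂ m` (`multichoose K m ≤ (m+1)^(K−1)`, tree `multichoose_le_succ_pow`),
and the rows `Φ_Toep(m, 1) = 1`, `Φ_Toep(m, 2) ≤ m + 1` drop out. [folklore] -/
theorem slopeClassInstanceBound_multichoose (m K : ℕ) : SlopeClassInstanceBound m K (Nat.multichoose K m) := by
  classical
  intro c w α P N θ' τ hθ hτ hP hopt
  have hX := chain_slopeSum_strictMono (fun δ => w (c δ)) α P θ' τ hθ hτ hP hopt
  let M : Fin (N + 1) → Sym (Fin K) m := fun k =>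
    Sym.mk (univ.val.map fun b : Fin m => c ((τ k b : ℤ) - b)) (by simp)
  have hM : Function.Injective M := by
    intro k k' hkk'
    have hv : (univ.val.map fun b : Fin m => c ((τ k b : ℤ) - b)) =
        univ.val.map fun b : Fin m => c ((τ k' b : ℤ) - b) :=
      congrArg Subtype.val hkk'
    apply hX.injective
    show ∑ b, w (c ((τ k b : ℤ) - b)) = ∑ b, w (c ((τ k' b : ℤ) - b))
    rw [sum_slopeClass_eq_multiset, sum_slopeClass_eq_multiset, hv]
  have hcard := Fintype.card_le_of_injective M hM
  rwa [Fintype.card_fin, Sym.card_sym_eq_multichoose, Fintype.card_fin] at hcard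

/-- row `K = 1` (exact): a constant slope function freezes the optimum, `Φ_Toep(m, 1) = 1`. [folklore] -/
theorem slopeClassInstanceBound_one (m : ℕ) : SlopeClassInstanceBound m 1 1 := by
  simpa using slopeClassInstanceBound_multichoose m 1

/-- row `K = 2`: `Φ_Toep(m, 2) ≤ m + 1` (located `= m + 1` at `m = 6, 7, 8`, seat tool `clsk`). [folklore] -/
theorem slopeClassInstanceBound_two (m : ℕ) : SlopeClassInstanceBound m 2 (m + 1) := by
  simpa [Nat.multichoose_two] using slopeClassInstanceBound_multichoose m 2

/-- the thin regime in law shape: `Φ_Toep(m, K) ≤ (m+1)^(K−1) ≤ 2^((K−1)(⌊log₂ m⌋+1))` — polynomial for bounded `K`,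
inside `2^{C(K + log² m)}` exactly when `K = O(log m)` («`O(log m)` bits per class» is free; T_K asks for `O(1)`). [folklore] -/
theorem slopeClassInstanceBound_thin (m K : ℕ) :
    SlopeClassInstanceBound m K (2 ^ ((K - 1) * (Nat.log 2 m + 1))) := by
  refine (slopeClassInstanceBound_multichoose m K).mono ((multichoose_le_succ_pow K m).trans ?_)
  calc (m + 1) ^ (K - 1) ≤ (2 ^ (Nat.log 2 m + 1)) ^ (K - 1) :=
        Nat.pow_le_pow_left (Nat.lt_pow_succ_log_self one_lt_two m) _
    _ = 2 ^ ((K - 1) * (Nat.log 2 m + 1)) := by rw [← pow_mul, mul_comm]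

end Counting

end Summit.ValiantsHypothesis.ValiantsHypothesis.Theorems.KPlusLogSqLaw.Toeplitz
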